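import Summits.NavierStokesRegularity.NavierStokesRegularity.Theorems.QuarterLogPincerLogCubeSharpAssembly
import Summits.NavierStokesRegularity.NavierStokesRegularity.Theses.QuarterLogPincer
import Literature.Analysis.FluidPDE.PressureNormalisationLp
import Literature.Analysis.FluidPDE.TaoEnstrophyLocalisationProofs
import Literature.Analysis.FluidPDE.NSWeakStrongUniquenessProofs
import HarnessLib

/-!
# `QuarterLogPincer.LogCubeSharp` (item stmt-NavierStokesRegularity-23935): under the quarter-rate
# enstrophy law and the velocity Type-I rate, the CUBE of the `L³` norm grows at most logarithmically

**Statement (the route decl, verbatim).** For a classical solution `(u,p)` of the unforced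
Navier–Stokes system on `ℝ³ × [0,T)` (`ν, T > 0`), Leray–Hopf from its rapidly decaying datum, with
`∫|curl u(t)|² ≤ K/√(T−t)` on `[0,T)` and the velocity Type-I rate `IsTypeIBlowup u T`, there are
`C₁, C₂` with `‖u(t)‖_{L³}³ ≤ C₁ + C₂ log(T/(T−t))` for all `t ∈ [0,T)` — the template rate of a
`|y|⁻¹`-tailed Type-I profile, sharpening the landed `LogCubeCeiling` (norm, not cube, `≤ C log`).

PROOF — the planner's two-rung ladder (line card `LogCubeSharp_line.md`), all rungs landed:
* RUNG 1 (`…LFour.lean`, Duhamel road, Type-I-free): `‖u(t)‖₄² ≤ V₁ + V₂(T−t)^{-1/4}`.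
* RUNG 2 (`…PhiTools/PhiSlice/PhiEnergy.lean`, the `L³` energy identity with the smooth regularised
  cube `Φ(v) = (‖v‖²+1)^{3/2} − 1 ≥ ‖v‖³`): on the Tao-class cover of `[0,t]`,
  `∫Φ(u(t)) ≤ ∫Φ(u(0)) + ∫₀ᵗ 3 m(τ) a(τ) b(τ) dτ` with `m = ‖u(τ)‖_∞`, `a = ‖p(τ) − C(τ)‖₂`,
  `b = ‖Du(τ)‖₂` (dissipation `≤ 0`, transport `= 0`, pressure integrated by parts onto the weight).
* INPUTS: the GLOBAL Type-I majorant `m ≤ C_I/√(T−τ)` (`exists_global_typeI`); the frame pressure is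
  the Riesz pressure up to a constant with `‖p(τ) − C(τ)‖₂ ≤ C_R‖u(τ)‖₄²`
  (`PressureNormalisationLp.exists_pressure_sub_const_memLp`, Tao 2013 Lemma 4.1 (i) /
  Nečas–Růžička–Šverák; uniform `L⁴` bound on `(0,(t+T)/2)` from rung 1), hence
  `a ≤ C_R(V₁ + V₂(T−τ)^{-1/4})`; and `b ≤ ‖curl u(τ)‖₂ ≤ √K⁺(T−τ)^{-1/4}` (div-free).
  So the integrand is `A₁(T−τ)^{-3/4} + A₂(T−τ)^{-1}`, `A = 3C_IC_R√K⁺`, integrating to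
  `4A V₁ T^{1/4} + A V₂ log(T/(T−t))`; finally `‖u(t)‖₃³ ≤ ∫Φ(u(t))`, `C₁ = ∫Φ(u(0)) + 4AV₁T^{1/4}`,
  `C₂ = AV₂`.

HONEST FRAMING: a conditional a-priori estimate for a GIVEN classical solution under a HYPOTHESISED
enstrophy law and Type-I rate; the quarter law (`EnstrophyQuarterLaw`, stmt-1574) and the deciding
crux `SuperlogCubeRate` stay open. Navier–Stokes regularity is NOT proved by this file, nor claimed.
References: Escauriaza–Seregin–Šverák 2003 / Seregin 2012 (`L³` energy method); Tao 2013 Lemma 4.1;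
Kato 1984; Lemarié-Rieusset 2016 Thm. 7.5. [folklore]
-/

noncomputable section

open MeasureTheory TopologicalSpace Set Function Filter Topology InnerProductSpace
open Literature.Analysis Literature.Analysis.FluidPDE
open scoped RealInnerProductSpace ENNReal NNReal Laplacian

namespace Summit.NavierStokesRegularity.NavierStokesRegularity.Theorems

-- the problem directory repeats the summit name (`NavierStokesRegularity/NavierStokesRegularity`)
set_option linter.dupNamespace false

namespace LogCubeSharp

/-! ### The crux -/

section Closing

open Summit.NavierStokesRegularity.NavierStokesRegularity.Theorems.RungReynoldsOne (stub_taoCover)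

/-- **Item stmt-NavierStokesRegularity-23935** (`QuarterLogPincer.LogCubeSharp`, the sharp converter
of the pincer): for a classical solution of the unforced Navier–Stokes system on `ℝ³ × [0,T)`
(`ν, T > 0`), Leray–Hopf from its rapidly decaying datum, the quarter-rate enstrophy law
`∫|curl u(t)|² ≤ K/√(T−t)` and the velocity Type-I rate give
`‖u(t)‖_{L³}³ ≤ C₁ + C₂ log(T/(T−t))` on `[0,T)`. Proof (the planner's two-rung ladder): rung 1
`‖u(t)‖₄² ≤ V₁ + V₂(T−t)^{-1/4}` (Duhamel, landed `exists_eLpNorm_four_sq_le`); rung 2 the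
regularised `L³` energy inequality `∫Φ(u(t)) ≤ ∫Φ(u(0)) + ∫₀ᵗ 3‖u‖_∞‖p − C‖₂‖Du‖₂`
(`integral_phi_le_of_slice_le` on the Tao-class cover of `[0,t]`, slice bound
`integral_rho_inner_timeDeriv_le` with the frame pressure renormalised to its Riesz pressure,
`‖p(τ) − C(τ)‖₂ ≤ C_R‖u(τ)‖₄²`, Tao 2013 Lemma 4.1 / Nečas–Růžička–Šverák), fed by the GLOBAL Type-I
majorant `‖u(τ)‖_∞ ≤ C_I/√(T−τ)` and `‖Du(τ)‖₂ ≤ ‖curl u(τ)‖₂ ≤ √K (T−τ)^{-1/4}`: the integrand is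
`A₁(T−τ)^{-3/4} + A₂(T−τ)^{-1}`, which integrates to `4A₁T^{1/4} + A₂ log(T/(T−t))`, and
`‖u(t)‖₃³ ≤ ∫Φ(u(t))`. HONEST FRAMING: a conditional a-priori estimate under the HYPOTHESISED
quarter law and Type-I rate; `EnstrophyQuarterLaw` (stmt-1574) and the deciding crux stay open;
Navier–Stokes regularity is NOT proved here, nor claimed. [folklore] -/
theorem logCubeSharp_proof :
    Summit.NavierStokesRegularity.NavierStokesRegularity.Theses.QuarterLogPincer.LogCubeSharp := by
  unfold Summit.NavierStokesRegularity.NavierStokesRegularity.Theses.QuarterLogPincer.LogCubeSharp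
  intro ν T hν hT u p hcl hLH hdec K hK hI
  have hclO : IsClassicalNSSolutionOn (Ioo 0 T) ν 0 u p :=
    hcl.mono Ioo_subset_Ico_self (uniqueDiffOn_Ioo 0 T)
  -- ### rung 1 and the global Type-I majorant
  obtain ⟨W₁, W₂, hW₁, hW₂, -, hW⟩ := exists_eLpNorm_four_le hν hT hcl hLH hdec hK
  obtain ⟨V₁, V₂, hV₁, hV₂, hV⟩ := exists_eLpNorm_four_sq_le hν hT hcl hLH hdec hK
  obtain ⟨CI, hCI0, hCI⟩ := exists_global_typeI hT hI (fun t₁ ht₁ => by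
    obtain ⟨q₁, hcl₁, hu₁, -, -⟩ := stub_taoCover hν hT hcl hLH hdec ht₁
    obtain ⟨B, -, hB⟩ := exists_forall_norm_le_of_hasBoundedSobolevNormsOn hcl₁ hu₁
    exact ⟨B, hB⟩)
  -- ### the Riesz-pressure constant of the frame pair `(u, p)`
  obtain ⟨Cq, hCq⟩ := PressureNormalisationLp.exists_pressure_sub_const_memLp
    (u := u) (p := p) (ν := ν) (q := (2 : ℝ)) one_lt_two
  have e22 : ENNReal.ofReal (2 : ℝ) * 2 = 4 := by rw [ENNReal.ofReal_ofNat]; norm_num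
  have e2 : ENNReal.ofReal (2 : ℝ) = 2 := ENNReal.ofReal_ofNat 2
  -- ### the datum: `Φ₀ = ∫ Φ(u 0)`
  obtain ⟨q₀, hcl₀, hu₀, -, -⟩ := stub_taoCover hν hT hcl hLH hdec (T' := T / 2)
    ⟨by positivity, by linarith⟩
  obtain ⟨B₀, hB₀0, hB₀⟩ := exists_forall_norm_le_of_hasBoundedSobolevNormsOn hcl₀ hu₀
  have hE0 : ∫⁻ x, ‖u 0 x‖ₑ ^ 2 < ⊤ :=
    (hLH.lintegral_enorm_sq_le hν.le ⟨le_rfl, hT.le⟩).trans_lt ENNReal.ofReal_lt_top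
  have hΦint : ∀ {v : EuclideanSpace ℝ (Fin 3) → EuclideanSpace ℝ (Fin 3)} {M : ℝ},
      Continuous v → (∀ x, ‖v x‖ ≤ M) → ∫⁻ x, ‖v x‖ₑ ^ 2 < ⊤ →
      Integrable (fun x => Real.sqrt (‖v x‖ ^ 2 + 1) ^ 3 - 1) volume := by
    intro v M hc hM h2
    have hM0 : 0 ≤ M := (norm_nonneg _).trans (hM 0)
    have hm2 : MemLp v 2 volume :=
      ⟨hc.aestronglyMeasurable, eLpNorm_two_lt_top_of_lintegral_enorm_sq_lt_top h2⟩
    refine Integrable.mono' ((integrable_norm_sq hm2).const_mul (M + 3 / 2))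
      ((((hc.norm.pow 2).add continuous_const).sqrt.pow 3).sub continuous_const).aestronglyMeasurable
      (Eventually.of_forall fun x => ?_)
    rw [Real.norm_eq_abs, abs_of_nonneg (phi_nonneg (v x))]
    refine (phi_le (v x)).trans ?_
    gcongr
    exact hM x
  set Φ₀ : ℝ := ∫ x, (Real.sqrt (‖u 0 x‖ ^ 2 + 1) ^ 3 - 1) with hΦ₀def
  have hΦ₀int := hΦint (hcl.contDiff_velocity ⟨le_rfl, hT⟩).continuous (hB₀ 0 ⟨le_rfl, by positivity⟩) hE0
  have hcube0 : eLpNorm (u 0) 3 volume ^ (3 : ℕ) ≤ ENNReal.ofReal Φ₀ :=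
    eLpNorm_three_pow_three_le_ofReal_integral hΦ₀int fun x => norm_pow_three_le_phi (u 0 x)
  have hΦ₀0 : 0 ≤ Φ₀ := integral_nonneg fun x => phi_nonneg (u 0 x)
  -- ### the constants
  set A : ℝ := 3 * (CI * ((Cq : ℝ) * Real.sqrt (max K 0))) with hA
  have hA0 : 0 ≤ A := by positivity
  refine ⟨Φ₀ + 4 * (A * V₁) * T ^ (1 / 4 : ℝ), A * V₂, fun t ht => ?_⟩
  have hlog : 0 ≤ Real.log (T / (T - t)) :=
    Real.log_nonneg ((one_le_div (sub_pos.2 ht.2)).2 (by linarith [ht.1]))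
  rcases eq_or_lt_of_le ht.1 with h0 | ht0
  · -- `t = 0`
    rw [← h0]
    refine hcube0.trans (ENNReal.ofReal_le_ofReal ?_)
    rw [← h0] at hlog
    have : 0 ≤ 4 * (A * V₁) * T ^ (1 / 4 : ℝ) := by positivity
    nlinarith [mul_nonneg (mul_nonneg hA0 hV₂) hlog]
  -- ### `0 < t < T`: the Tao-class cover of `[0, t]`
  obtain ⟨q, hclq, huq, hutq, -⟩ := stub_taoCover hν hT hcl hLH hdec (T' := t) ⟨ht0, ht.2⟩
  obtain ⟨B, hB0, hB⟩ := exists_forall_norm_le_of_hasBoundedSobolevNormsOn hclq huq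
  obtain ⟨C₀, hC₀⟩ := huq 0
  obtain ⟨C₁, hC₁⟩ := huq 1
  obtain ⟨C₂, hC₂⟩ := huq 2
  obtain ⟨Ct, hCt⟩ := hutq 0
  have hu0' : ∀ s ∈ Icc 0 t, ∫⁻ x, ‖u s x‖ₑ ^ 2 ≤ C₀ := fun s hs =>
    (le_of_eq (lintegral_congr fun x => by
      rw [← ofReal_norm, ← norm_iteratedFDeriv_zero (𝕜 := ℝ) (f := u s), ofReal_norm])).trans (hC₀ s hs)
  have hut0' : ∀ s ∈ Icc 0 t, ∫⁻ x, ‖timeDerivWithin (Icc 0 t) u s x‖ₑ ^ 2 ≤ Ct := fun s hs =>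
    (le_of_eq (lintegral_congr fun x => by
      rw [← ofReal_norm, ← norm_iteratedFDeriv_zero (𝕜 := ℝ) (f := timeDerivWithin (Icc 0 t) u s),
        ofReal_norm])).trans (hCt s hs)
  -- ### the uniform `L⁴` bound on `(0, t')`, `t' = (t + T)/2`, and the pressure at each time
  set t' : ℝ := (t + T) / 2 with ht'
  have htt' : t < t' := by rw [ht']; linarith [ht.2]
  have ht'T : t' < T := by rw [ht']; linarith [ht.2]
  have hTt' : 0 < T - t' := sub_pos.2 ht'T
  have hclO' : IsClassicalNSSolutionOn (Ioo 0 t') ν 0 u p :=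
    hcl.mono (fun s hs => ⟨hs.1.le, hs.2.trans ht'T⟩) (uniqueDiffOn_Ioo 0 t')
  set M₄ : ℝ≥0 := (W₁ + W₂ * (T - t') ^ (-(1 / 8 : ℝ))).toNNReal with hM₄
  have hmem4 : ∀ s ∈ Ioo 0 t', MemLp (u s) (ENNReal.ofReal 2 * 2) volume := by
    intro s hs
    rw [e22]
    have hsI : s ∈ Ico 0 T := ⟨hs.1.le, hs.2.trans ht'T⟩
    exact ⟨(hcl.contDiff_velocity hsI).continuous.aestronglyMeasurable,
      (hW s hsI).trans_lt ENNReal.ofReal_lt_top⟩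
  have hM4 : ∀ s ∈ Ioo 0 t', eLpNorm (u s) (ENNReal.ofReal 2 * 2) volume ≤ M₄ := by
    intro s hs
    rw [e22]
    have hsI : s ∈ Ico 0 T := ⟨hs.1.le, hs.2.trans ht'T⟩
    refine (hW s hsI).trans ?_
    rw [hM₄]
    have hr : (T - s) ^ (-(1 / 8 : ℝ)) ≤ (T - t') ^ (-(1 / 8 : ℝ)) :=
      Real.rpow_le_rpow_of_nonpos hTt' (by linarith [hs.2]) (by norm_num)
    exact ENNReal.ofReal_le_ofReal (by nlinarith [mul_le_mul_of_nonneg_left hr hW₂])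
  have hpress := hCq 0 t' hν.le hclO' M₄ hmem4 hM4
  -- ### the majorant `D`
  set D : ℝ → ℝ := fun τ => A * V₁ * (T - τ) ^ (-(3 / 4 : ℝ)) + A * V₂ * (T - τ)⁻¹ with hD
  have hDi : IntegrableOn D (Ioo 0 t) volume := integrableOn_majorant ht.2
  -- ### the slice bound at every `τ ∈ (0, t)`
  have hslice : ∀ τ ∈ Ioo 0 t,
      ∫ x, 3 * Real.sqrt (‖u τ x‖ ^ 2 + 1) * ⟪u τ x, timeDerivWithin (Icc 0 t) u τ x⟫ ≤ D τ := by
    intro τ hτ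
    have hτT : τ ∈ Ioo 0 T := ⟨hτ.1, hτ.2.trans ht.2⟩
    have hτT' : τ ∈ Ico 0 T := ⟨hτ.1.le, hτT.2⟩
    have hτt' : τ ∈ Ioo 0 t' := ⟨hτ.1, hτ.2.trans htt'⟩
    have hτI : τ ∈ Icc 0 t := ⟨hτ.1.le, hτ.2.le⟩
    have hTτ : 0 < T - τ := sub_pos.2 hτT.2
    -- the time derivative within the open frame
    have e : ∀ x, timeDerivWithin (Icc 0 t) u τ x = timeDerivWithin (Ioo 0 T) u τ x := fun x => by
      rw [timeDerivWithin_eq_deriv_of_mem_nhds (Icc_mem_nhds hτ.1 hτ.2) u x,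
        timeDerivWithin_eq_deriv_of_mem_nhds (Ioo_mem_nhds hτT.1 hτT.2) u x]
    simp_rw [e]
    -- the renormalised pressure
    obtain ⟨Cτ, hpm, hpb, -⟩ := hpress τ hτt'
    rw [e2] at hpm hpb
    rw [show (2 : ℝ≥0∞) * 2 = 4 by norm_num] at hpb
    have hcl' := isClassicalNSSolutionOn_sub_const hclO Cτ
    -- the data at time `τ`
    have hu2τ : MemLp (u τ) 2 volume :=
      ⟨(hcl.contDiff_velocity hτT').continuous.aestronglyMeasurable,
        eLpNorm_two_lt_top_of_lintegral_enorm_sq_lt_top ((hu0' τ hτI).trans_lt ENNReal.coe_lt_top)⟩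
    have hDuτ : MemLp (fun x => fderiv ℝ (u τ) x) 2 volume := by
      refine ⟨((hcl.contDiff_velocity hτT').continuous_fderiv (by norm_cast)).aestronglyMeasurable,
        eLpNorm_two_lt_top_of_lintegral_enorm_sq_lt_top ?_⟩
      refine lt_of_le_of_lt (le_of_eq (lintegral_congr fun x => ?_)) ((hC₁ τ hτI).trans_lt ENNReal.coe_lt_top)
      rw [← ofReal_norm, ← norm_iteratedFDeriv_one (𝕜 := ℝ) (f := u τ), ofReal_norm]
    have hD2uτ : MemLp (fun x => iteratedFDeriv ℝ 2 (u τ) x) 2 volume :=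
      ⟨((hcl.contDiff_velocity hτT').continuous_iteratedFDeriv (by norm_cast)).aestronglyMeasurable,
        eLpNorm_two_lt_top_of_lintegral_enorm_sq_lt_top ((hC₂ τ hτI).trans_lt ENNReal.coe_lt_top)⟩
    have hutτ : MemLp (fun x => timeDerivWithin (Ioo 0 T) u τ x) 2 volume := by
      have hm : AEStronglyMeasurable (fun x => timeDerivWithin (Icc 0 t) u τ x) volume := by
        have hc := hclq.smooth_velocity.continuousOn_timeDerivWithin (uniqueDiffOn_Icc ht0)
        exact (hc.comp_continuous (continuous_const.prodMk continuous_id)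
          fun x => ⟨hτI, mem_univ _⟩).aestronglyMeasurable
      have h1 : MemLp (fun x => timeDerivWithin (Icc 0 t) u τ x) 2 volume :=
        ⟨hm, eLpNorm_two_lt_top_of_lintegral_enorm_sq_lt_top ((hut0' τ hτI).trans_lt ENNReal.coe_lt_top)⟩
      exact h1.congr_norm (hm.congr (Eventually.of_forall fun x => e x))
        (Eventually.of_forall fun x => by rw [e x])
    have hDq : MemLp (fun x => gradient (fun y => p τ y - Cτ) x) 2 volume :=
      memLp_gradient_pressure hcl' hτT (hCI τ hτT') hDuτ hD2uτ hutτ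
    -- the three majorants
    have hqa : eLpNorm (fun x => p τ x - Cτ) 2 volume ≤
        ENNReal.ofReal ((Cq : ℝ) * (V₁ + V₂ * (T - τ) ^ (-(1 / 4 : ℝ)))) := by
      refine hpb.trans ?_
      rw [ENNReal.ofReal_mul (NNReal.coe_nonneg _), ENNReal.ofReal_coe_nnreal]
      exact mul_le_mul' le_rfl (hV τ hτT')
    have hDub : eLpNorm (fun x => fderiv ℝ (u τ) x) 2 volume ≤
        ENNReal.ofReal (Real.sqrt (max K 0) * (T - τ) ^ (-(1 / 4 : ℝ))) := by
      have h1 := eLpNorm_two_le_lintegral_frobenius_rpow (volume : Measure (EuclideanSpace ℝ (Fin 3)))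
        (fun x => fderiv ℝ (u τ) x)
      have h2 := lintegral_frobeniusNormSq_fderiv_le_lintegral_sq_norm_curl
        ((hcl.contDiff_velocity hτT').of_le (by norm_cast)) (hcl.divFree τ hτT')
        ((hu0' τ hτI).trans_lt ENNReal.coe_lt_top)
      have h3 : ∫⁻ x, ‖curl (u τ) x‖ₑ ^ 2 ≤ ENNReal.ofReal (max K 0 * (T - τ) ^ (-(1 / 2 : ℝ))) := by
        refine (hK τ hτT').trans (ENNReal.ofReal_le_ofReal ?_)
        rw [Real.sqrt_eq_rpow, div_eq_mul_inv, ← Real.rpow_neg hTτ.le]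
        exact mul_le_mul_of_nonneg_right (le_max_left _ _) (Real.rpow_nonneg hTτ.le _)
      refine h1.trans ((ENNReal.rpow_le_rpow (h2.trans h3) (by norm_num)).trans (le_of_eq ?_))
      rw [ENNReal.ofReal_rpow_of_nonneg (by positivity) (by norm_num),
        Real.mul_rpow (le_max_right _ _) (Real.rpow_nonneg hTτ.le _), ← Real.sqrt_eq_rpow,
        ← Real.rpow_mul hTτ.le]
      norm_num
    have hs := integral_rho_inner_timeDeriv_le hν.le hcl' hτT (hCI τ hτT') (by positivity)
      (by positivity) hu2τ hDuτ hD2uτ hpm hDq hqa hDub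
    refine hs.trans (le_of_eq ?_)
    -- algebra of the rates
    have hsq : Real.sqrt (T - τ) = (T - τ) ^ (1 / 2 : ℝ) := Real.sqrt_eq_rpow _
    rw [hD]
    simp only
    rw [hA, hsq, div_eq_mul_inv, ← Real.rpow_neg hTτ.le]
    have r1 : (T - τ) ^ (-(1 / 2 : ℝ)) * (T - τ) ^ (-(1 / 4 : ℝ)) = (T - τ) ^ (-(3 / 4 : ℝ)) := by
      rw [← Real.rpow_add hTτ]; norm_num
    have r2 : (T - τ) ^ (-(1 / 2 : ℝ)) * (T - τ) ^ (-(1 / 4 : ℝ)) * (T - τ) ^ (-(1 / 4 : ℝ)) =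
        (T - τ)⁻¹ := by
      rw [← Real.rpow_add hTτ, ← Real.rpow_add hTτ, ← Real.rpow_neg_one]; norm_num
    linear_combination (3 * CI * (Cq : ℝ) * Real.sqrt (max K 0) * V₁) * r1 +
      (3 * CI * (Cq : ℝ) * Real.sqrt (max K 0) * V₂) * r2
  -- ### the slab inequality and the conclusion
  have key := integral_phi_le_of_slice_le ht0 hclq hB ENNReal.coe_lt_top ENNReal.coe_lt_top
    hu0' hut0' hDi hslice
  have hmaj := integral_majorant_le (A₁ := A * V₁) (A₂ := A * V₂) ht0 ht.2 (by positivity)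
  have hΦtint := hΦint (hcl.contDiff_velocity ⟨ht.1, ht.2⟩).continuous (hB t ⟨ht0.le, le_rfl⟩)
    ((hu0' t ⟨ht0.le, le_rfl⟩).trans_lt ENNReal.coe_lt_top)
  refine (eLpNorm_three_pow_three_le_ofReal_integral hΦtint fun x => norm_pow_three_le_phi (u t x)).trans
    (ENNReal.ofReal_le_ofReal ?_)
  have hDdef : (∫ τ in Ioo 0 t, D τ) =
      ∫ τ in Ioo 0 t, (A * V₁ * (T - τ) ^ (-(3 / 4 : ℝ)) + A * V₂ * (T - τ)⁻¹) := rfl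
  rw [hDdef] at key
  nlinarith [key, hmaj]

end Closing

end LogCubeSharp

end Summit.NavierStokesRegularity.NavierStokesRegularity.Theorems

end
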